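import Summits.ValiantsHypothesis.ValiantsHypothesis.Theorems.RefutationDegreeBeyondHessianNsStubDetPrimeOverDomain

/-!
# LangWeilTransfer, support item `LangWeilBound` (stmt-ValiantsHypothesis-6376) — helpers

Route `LangWeilTransfer` of `ValiantsHypothesis`, support item `LangWeilBound` (effective
Lang–Weil with avoidance). Two preliminaries for the derivation from the tree's Cafure–Matera
theorems: (1) **descent**: for `Q` absolutely irreducible over a field `K` and `Q ∤ G` in `K[X]`,
the images of `Q` and `G` in `K̄[X]` are relatively prime (contraction lemma
`RefutationDegreeBeyondHessianNs.dvd_of_map_dvd_map` of the tree: over a field every nonzero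
polynomial has a unit leading coefficient for the lexicographic monomial order); (2) the
**univariate case** `m = 0`: an absolutely irreducible `Q ∈ K[X₀]` is linear, hence has a
`K`-rational root `r`, and `Q ∤ G` forces `G(r) ≠ 0` (via `MvPolynomial.uniqueAlgEquiv`). Honest
framing: bookkeeping inside a dormant route whose cruxes are open; nothing here bears on VP ≠ VNP.
-/

noncomputable section

open MvPolynomial

-- the summit and the problem share the name `ValiantsHypothesis` (D-0017 single-conjunct layout)
set_option linter.dupNamespace false

namespace Summit.ValiantsHypothesis.ValiantsHypothesis.Theorems.LangWeilTransfer

open Summit.ValiantsHypothesis.ValiantsHypothesis.Theorems.RefutationDegreeBeyondHessianNs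
  (dvd_of_map_dvd_map)

/-- **Descent.** If `Q` is absolutely irreducible over the field `K` and `Q ∤ G` in `K[X_σ]`, then
the images of `Q` and `G` in `K̄[X_σ]` are relatively prime. -/
theorem isRelPrime_map_of_not_dvd {K : Type*} [Field K] {σ : Type*} [LinearOrder σ]
    [WellFoundedGT σ] {Q G : MvPolynomial σ K}
    (hQ : Irreducible (MvPolynomial.map (algebraMap K (AlgebraicClosure K)) Q)) (hG : ¬ Q ∣ G) :
    IsRelPrime (MvPolynomial.map (algebraMap K (AlgebraicClosure K)) Q)
      (MvPolynomial.map (algebraMap K (AlgebraicClosure K)) G) := by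
  rw [hQ.isRelPrime_iff_not_dvd]
  intro h
  apply hG
  have hQ0 : Q ≠ 0 := by
    rintro rfl
    rw [map_zero] at hQ
    exact not_irreducible_zero hQ
  exact dvd_of_map_dvd_map MonomialOrder.lex (algebraMap K (AlgebraicClosure K)).injective
    (MonomialOrder.isUnit_leadingCoeff.mpr hQ0) h

/-- `uniqueAlgEquiv` commutes with base change. -/
theorem uniqueAlgEquiv_map {R S : Type*} [CommSemiring R] [CommSemiring S] (f : R →+* S)
    (p : MvPolynomial (Fin 1) R) :
    uniqueAlgEquiv S (Fin 1) (MvPolynomial.map f p) =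
      Polynomial.map f (uniqueAlgEquiv R (Fin 1) p) := by
  ext n
  rw [coeff_uniqueAlgEquiv, coeff_map, Polynomial.coeff_map, coeff_uniqueAlgEquiv]

/-- Evaluation through `uniqueAlgEquiv`. -/
theorem eval_uniqueAlgEquiv {R : Type*} [CommSemiring R] (p : MvPolynomial (Fin 1) R) (r : R) :
    Polynomial.eval r (uniqueAlgEquiv R (Fin 1) p) = MvPolynomial.eval (fun _ => r) p := by
  induction p using MvPolynomial.induction_on with
  | C a => simp
  | add p q hp hq => simp only [map_add, Polynomial.eval_add, hp, hq]
  | mul_X p i hp =>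
    have hX : uniqueAlgEquiv R (Fin 1) (X i) = Polynomial.X := by simp [uniqueAlgEquiv_apply]
    rw [map_mul, Polynomial.eval_mul, hp, hX, Polynomial.eval_X, map_mul, eval_X]

/-- **The univariate case of `LangWeilBound`.** An absolutely irreducible `Q ∈ K[X₀]` is linear,
so it has a `K`-rational root `r`; if `Q ∤ G` then `G(r) ≠ 0`. -/
theorem exists_point_fin_one {K : Type*} [Field K] (Q G : MvPolynomial (Fin 1) K)
    (hQ : Irreducible (MvPolynomial.map (algebraMap K (AlgebraicClosure K)) Q)) (hG : ¬ Q ∣ G) :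
    ∃ x : Fin 1 → K, MvPolynomial.aeval x Q = 0 ∧ MvPolynomial.aeval x G ≠ 0 := by
  set L := AlgebraicClosure K
  set e := uniqueAlgEquiv K (Fin 1) with he
  have hirr : Irreducible (Polynomial.map (algebraMap K L) (e Q)) := by
    rw [he, ← uniqueAlgEquiv_map]
    exact (MulEquiv.irreducible_iff (uniqueAlgEquiv L (Fin 1))).mpr hQ
  have hdeg1 : (e Q).degree = 1 := by
    have := IsAlgClosed.degree_eq_one_of_irreducible L hirr
    rwa [Polynomial.degree_map] at this
  obtain ⟨r, hr⟩ := Polynomial.exists_root_of_degree_eq_one hdeg1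
  have heval : ∀ (p : MvPolynomial (Fin 1) K), MvPolynomial.aeval (fun _ : Fin 1 => r) p =
      Polynomial.eval r (e p) := fun p => by
    rw [he, eval_uniqueAlgEquiv]; rfl
  refine ⟨fun _ => r, ?_, ?_⟩
  · rw [heval]; exact hr
  · intro h0
    rw [heval] at h0
    apply hG
    -- `e Q = (X - C r) · u` with `u` a unit, and `(X - C r) ∣ e G`
    obtain ⟨u, hu⟩ := (Polynomial.dvd_iff_isRoot.mpr hr : Polynomial.X - Polynomial.C r ∣ e Q)
    have hX0 : (Polynomial.X - Polynomial.C r : Polynomial K) ≠ 0 := Polynomial.X_sub_C_ne_zero r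
    have hu0 : u ≠ 0 := by
      rintro rfl
      rw [mul_zero] at hu
      rw [hu, Polynomial.degree_zero] at hdeg1
      exact absurd hdeg1 (by decide)
    have hnat : (e Q).natDegree = 1 := Polynomial.natDegree_eq_of_degree_eq_some hdeg1
    rw [hu, Polynomial.natDegree_mul hX0 hu0, Polynomial.natDegree_X_sub_C] at hnat
    have hudeg : u.natDegree = 0 := by omega
    have huunit : IsUnit u := by
      rw [Polynomial.eq_C_of_natDegree_eq_zero hudeg]
      refine Polynomial.isUnit_C.mpr (isUnit_iff_ne_zero.mpr fun hc => hu0 ?_)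
      rw [Polynomial.eq_C_of_natDegree_eq_zero hudeg, hc, map_zero]
    have hdvd : e Q ∣ e G := by
      rw [hu, huunit.mul_right_dvd]
      exact Polynomial.dvd_iff_isRoot.mpr h0
    exact (map_dvd_iff e).mp hdvd

end Summit.ValiantsHypothesis.ValiantsHypothesis.Theorems.LangWeilTransfer
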